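import Summits.BirchSwinnertonDyer.BirchSwinnertonDyer.Theorems.ByReductionTypeAtTwoAdditivePotGoodPrintKrizLi92b1Base
import Literature.NumberTheory.EllipticCurves.Curve37aRootNumber
import Literature.NumberTheory.EllipticCurves.Curve37aTorsion
import Literature.NumberTheory.EllipticCurves.OrdinaryPrimesProofs
import Literature.NumberTheory.EllipticCurves.LeadingTermTamagawaProofs
import Mathlib.Tactic.NormNum.LegendreSymbol
import HarnessLib

/-!
# Route `GenusKolyvaginAtTwo`, crux U₂ `MinimalTwinBSDTwo` (stmt-BirchSwinnertonDyer-22985), LINE 23 «twin_swap»: KERNEL data of the Kriz–Li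
# RANK-ONE ANCHOR `37a1 = [0,0,1,−1,0]` (Cremona Table 1 «37 A1»: `N = 37`, `r = 1`, `#T = 1`, `Δ = 37`, Kodaira `I₁` at `37`, GOOD at `2`;
# Kriz–Li Table 1 row `37a1 | −7 | 1 | ✓`) over `K = ℚ(√−7)` — global minimality, `E(ℚ)[2] = 0`, good (supersingular) reduction at `2` with
# `c₂ = 1`, non-CM, a point of infinite order (tree: `Curve37a`), `N = 37 < 5000`; the partner `37a1^{(−7)} = [0,0,1,−49,−86]` (`I₀*` at `7`,
# `I₁` at `37`: `N = 7²·37 = 1813 < 5000`); the packet witness `ℓ = 53` (`#Ẽ(𝔽₅₃) = 53`, `a₅₃ = 1` odd)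

Seat `bsd-line-gk2-p2` g34 (PROVER 2/3, cell `bsd-f1-sign2`; LINE 23 holder), `--supports stmt-BirchSwinnertonDyer-22985` (helper; closes nothing).
KERNEL THEOREMS ONLY (0 `def`, 0 `sorry`, no named fact); standard axioms.  The U₂-side twin of the K4 seat's `…PrintKrizLi92b1Base.lean`
(cell `bsd-2adic`): `37a1` is the FIRST rank-one curve and the first row of Kriz–Li's Table 1; with `43a1` and `92b1` it is one of the three
rank-one rows with `c₂(E)` odd and `d_K²·N < 5000`, i.e. for which BOTH numerical `BSD(2)` inputs of Kriz–Li Thm 5.1 (2) — the base `E` and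
its companion `E^{(d_K)}` — lie in Creutz–Miller's range, so that `BSD₂` on the whole Kriz–Li packet `{37a1^{(d)}, 37a1^{(−7d)} : d ∈ 𝒩,
χ_d(−37) = 1}` follows from PRINT ALONE (road file `…KrizLiAnchor37a1.lean`).  The rank-one members `37a1^{(d)}` are non-CM curves of
analytic rank one — the class U₂ quantifies over — settled with NO research stub and NO rank-zero wall.  Everything here is kernel
arithmetic on the two models; the base invariants `Δ = 37`, `N = 37`, `E(ℚ)_tors = 0`, a point of infinite order are the tree's
(`Literature/…/Curve37aRootNumber.lean`, `…/Curve37aTorsion.lean`).  Tate certificate at `7` for the partner: the b2b engine `DeepCert`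
(exit `6` = `I₀*`, translation `t = 24`).  Closes nothing; nothing booked; **BSD is NOT proved by any of this; U₂ is NOT proved.**

References: [KrizLi2019] Thm 5.1 (2), Def 4.1, §6 Table 1 (row 37a1); [CremonaAlgorithms1997] Table 1 (37A1; 1813); [SilvermanAEC2009] VII.1,
VII.5, X.5, App. C §11; [Silverman1994] IV.9.4, IV.11.1; [Kraus1989] Prop. 1–2.
-/

set_option autoImplicit false
-- the Theorems namespace of this sub repeats the summit name by design (D-0017 nested layout)
set_option linter.dupNamespace false

noncomputable section

open scoped Classical NumberField

open WeierstrassCurve IsDedekindDomain Rat.HeightOneSpectrum Literature.NumberTheory.EllipticCurves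
  Literature.NumberTheory.EllipticCurves.ModularForms
  Literature.NumberTheory.EllipticCurves.Rank1Residual
  Literature.NumberTheory.DiophantineGeometry
  Literature.NumberTheory.EllipticCurves.Curve37a
  Summit.BirchSwinnertonDyer
  Summit.BirchSwinnertonDyer.Rank1Residual
  Summit.BirchSwinnertonDyer.Rank1Residual.X11b
  Summit.BirchSwinnertonDyer.Rank1Residual.X5.O1
  Summit.BirchSwinnertonDyer.Rank1Residual.P2
  Summit.BirchSwinnertonDyer.BirchSwinnertonDyer.Rank1Residual.IntModel
  Summit.BirchSwinnertonDyer.BirchSwinnertonDyer.Theorems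
  Summit.BirchSwinnertonDyer.BirchSwinnertonDyer.Theorems.AddPotGoodPrint
  Summit.BirchSwinnertonDyer.BirchSwinnertonDyer.Rank2Observatory.Tate

namespace Summit.BirchSwinnertonDyer.BirchSwinnertonDyer.Theorems.GenusExact.TwinSwap.KrizLiAnchor37a1

/-! ## §1 The anchor `37a1 = Curve37a.E = [0, 0, 1, −1, 0]`: `Δ = 37`, `c₄ = 48`, GOOD at `2`, `I₁` at `37` -/
section Base37A1

/-- `37a1` is GLOBALLY MINIMAL (`|Δ| = 37`: `v_p Δ < 12` everywhere). [cite: SilvermanAEC2009, VII.1 Remark 1.1] [cite: Kraus1989, Prop. 1 and Prop. 2] -/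
theorem isGloballyMinimal_37A1 : E.IsGloballyMinimal :=
  isGloballyMinimal_of_krausCriterion_support (0) (0) (1) (-1) (0) [(37, 0, 1)]
    (by intro t ht; simp only [List.mem_cons, List.not_mem_nil, or_false] at ht
        rcases ht with rfl; norm_num)
    (by decide +kernel) (by decide +kernel)

/-- `c₄(37a1) = 48` on the integer model. [cite: CremonaAlgorithms1997, Table 1 (37A1)] -/
theorem M37A1_c₄ : (⟨0, 0, 1, -1, 0⟩ : WeierstrassCurve ℤ).c₄ = 48 := by decide +kernel
/-- `Δ(37a1) > 0` (rational model). [cite: CremonaAlgorithms1997, Table 1 (37A1)] -/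
theorem Δ_pos_37A1 : 0 < E.Δ := by rw [E_Δ]; norm_num

/-- The integer model of `37a1` is Cremona's. [cite: SilvermanAEC2009, VIII.8] -/
theorem intModel_37A1 :
    haveI := isGloballyMinimal_37A1
    integralModelInt E = (⟨0, 0, 1, -1, 0⟩ : WeierstrassCurve ℤ) :=
  haveI := isGloballyMinimal_37A1
  integralModelInt_eq_of_map_eq _ (by ext <;> simp [WeierstrassCurve.map, E])

/-- **`E(ℚ)[2] = 0` for `37a1`** in Kriz–Li's shape: `E(ℚ)` is torsion-free (tree `Curve37a.eq_zero_of_isOfFinAddOrder`, Lutz–Nagell at `2` and `3`).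
[cite: KrizLi2019, Thm. 5.1 hypothesis "E(ℚ)[2] = 0"] [cite: CremonaAlgorithms1997, Table 1 (37A1: |T| = 1)] -/
theorem twoTorsion_37A1 : ∀ Q : E.toAffine.Point, 2 • Q = 0 → Q = 0 :=
  fun _ hQ ↦ eq_zero_of_isOfFinAddOrder (isOfFinAddOrder_iff_nsmul_eq_zero.mpr ⟨2, two_pos, hQ⟩)

/-- `E[2]` is IRREDUCIBLE for `37a1` (no rational `2`-torsion). [cite: SilvermanAEC2009, III.2.3 (b)] -/
theorem irr_two_37A1 : Irr E 2 :=
  (X5.O1.irr_two_iff_forall_two_nsmul _).mpr twoTorsion_37A1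

/-- **`37a1` has GOOD reduction at `2`** (`2 ∤ Δ_min = 37`). [cite: SilvermanAEC2009, VII.5 Prop. 5.1 (a)] [cite: KrizLi2019, §6 Table 1 (row 37a1: c₂ = 1)] -/
theorem hasGoodReductionAtPrime_two_37A1 :
    haveI := isGloballyMinimal_37A1; haveI : Fact (Nat.Prime 2) := ⟨Nat.prime_two⟩
    E.HasGoodReductionAtPrime 2 := by
  haveI := isGloballyMinimal_37A1
  haveI : Fact (Nat.Prime 2) := ⟨Nat.prime_two⟩
  refine hasGoodReductionAtPrime_of_not_dvd E 2 ?_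
  rw [minimalDiscriminantInt_eq intModel_37A1, Δ_int]; decide

/-- **`c₂(37a1) = 1`** (good reduction: `E₀(ℚ₂) = E(ℚ₂)`, Tate's Step 1). [cite: SilvermanAEC2009, VII.2 remark after Prop. 2.1] [cite: KrizLi2019, §6 Table 1 (row 37a1: c₂ = 1)] -/
theorem localTamagawaNumber_two_37A1 :
    haveI : Fact (Nat.Prime 2) := ⟨Nat.prime_two⟩
    (E.baseChange ℚ_[2]).localTamagawaNumber ℤ_[2] = 1 :=
  haveI := isGloballyMinimal_37A1
  haveI : Fact (Nat.Prime 2) := ⟨Nat.prime_two⟩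
  localTamagawaNumber_padic_eq_one_of_good_holds E 2 hasGoodReductionAtPrime_two_37A1

/-- **`c₂(37a1)` is ODD** (`= 1`). [cite: KrizLi2019, Thm. 5.1 (hypothesis "c₂(E) odd") and §6 Table 1 (row 37a1)] -/
theorem odd_localTamagawaNumber_two_37A1 :
    haveI : Fact (Nat.Prime 2) := ⟨Nat.prime_two⟩
    Odd ((E.baseChange ℚ_[2]).localTamagawaNumber ℤ_[2]) := by
  rw [localTamagawaNumber_two_37A1]; exact odd_one

/-- **`37a1` is non-CM**: multiplicative at `37` (`37 ∣ Δ`, `37 ∤ c₄ = 48`), so `ord₃₇ j < 0`. [cite: SilvermanAEC2009, App. C §11] -/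
theorem not_hasCM_37A1 : ¬ E.HasCM := by
  haveI := isGloballyMinimal_37A1
  haveI : Fact (Nat.Prime 37) := ⟨by norm_num⟩
  exact AdditivePotMult.not_hasCM_of_padicValRat_j_neg (p := 37) (EisensteinPrimes.padicValRat_j_neg_of_mult _ 37
    (hasMultiplicativeReductionAtPrime_of_intModel intModel_37A1 37 (by rw [Δ_int]; decide) (by rw [M37A1_c₄]; decide)))

/-- **`N(37a1) = 37 < 5000`** (Creutz–Miller's range; `N = 37` is the tree's `Curve37a.conductorNorm_E`). [cite: CreutzMiller2012, Thm. 1.1] [cite: CremonaAlgorithms1997, Table 1 (37A1)] -/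
theorem conductorNorm_lt_5000_37A1 : E.conductorNorm ℤ < 5000 := by
  rw [conductorNorm_E]; norm_num

end Base37A1

/-! ## §2 The partner `T′ = 37a1^{(−7)} = [0,0,1,−49,−86]`: global minimal, `Δ = 7⁶·37`, `N(T′) = 7²·37 = 1813 < 5000` -/
section Partner37A1

/-- **The tree's quadratic twist `37a1^{(−7)}` IS `[0,0,0,−49,−343/4]`** (`(b₂, b₄, b₆) = (0, −2, 1)`). [cite: SilvermanAEC2009, X.5 Cor. 5.4] -/
theorem quadraticTwist_neg7_37A1 :
    E.quadraticTwist (-7) = (⟨0, 0, 0, -49, -343 / 4⟩ : WeierstrassCurve ℚ) := by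
  ext <;> norm_num [WeierstrassCurve.quadraticTwist, WeierstrassCurve.b₂, WeierstrassCurve.b₄, WeierstrassCurve.b₆, E]

/-- **`(1, 0, 0, ½) • 37a1^{(−7)} = [0,0,1,−49,−86]`** — Cremona's minimal model of the companion (complete the square back: `y ↦ y + ½`).
[cite: SilvermanAEC2009, III.1 Table 3.1 and X.5 Cor. 5.4] -/
theorem smul_quadraticTwist_neg7_37A1 :
    (⟨1, 0, 0, (1 : ℚ) / 2⟩ : VariableChange ℚ) • E.quadraticTwist (-7) = (⟨0, 0, 1, -49, -86⟩ : WeierstrassCurve ℚ) := by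
  rw [quadraticTwist_neg7_37A1]
  ext <;> norm_num [variableChange_a₁, variableChange_a₂, variableChange_a₃, variableChange_a₄, variableChange_a₆]

/-- `T′ = [0,0,1,−49,−86]` is an elliptic curve (`Δ = 7⁶·37 ≠ 0`). [cite: SilvermanAEC2009, III.1] -/
theorem isElliptic_T37A1 : (⟨0, 0, 1, -49, -86⟩ : WeierstrassCurve ℚ).IsElliptic := ⟨by
  rw [isUnit_iff_ne_zero]; norm_num [WeierstrassCurve.Δ, WeierstrassCurve.b₂, WeierstrassCurve.b₄, WeierstrassCurve.b₆, WeierstrassCurve.b₈]⟩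

/-- `T′` is GLOBALLY MINIMAL (`|Δ| = 7⁶·37`: `v_p Δ < 12` everywhere). [cite: SilvermanAEC2009, VII.1 Remark 1.1] [cite: Kraus1989, Prop. 1 and Prop. 2] -/
theorem isGloballyMinimal_T37A1 : (⟨0, 0, 1, -49, -86⟩ : WeierstrassCurve ℚ).IsGloballyMinimal :=
  isGloballyMinimal_of_krausCriterion_support (0) (0) (1) (-49) (-86) [(7, 0, 6), (37, 0, 1)]
    (by intro t ht; simp only [List.mem_cons, List.not_mem_nil, or_false] at ht
        rcases ht with rfl | rfl <;> norm_num)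
    (by decide +kernel) (by decide +kernel)

/-- `Δ(T′) = 4353013 = 7⁶·37`. [cite: CremonaAlgorithms1997, Table 1 (conductor 1813)] -/
theorem MT37A1_Δ : (⟨0, 0, 1, -49, -86⟩ : WeierstrassCurve ℤ).Δ = 4353013 := by decide +kernel
/-- `c₄(T′) = 2352 = 2⁴·3·7²`. [cite: CremonaAlgorithms1997, Table 1 (conductor 1813)] -/
theorem MT37A1_c₄ : (⟨0, 0, 1, -49, -86⟩ : WeierstrassCurve ℤ).c₄ = 2352 := by decide +kernel

/-- The integer model base-changed to `ℚ` is the rational model. [folklore] -/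
theorem baseChange_int_T37A1 :
    (⟨0, 0, 1, -49, -86⟩ : WeierstrassCurve ℤ).baseChange ℚ = (⟨0, 0, 1, -49, -86⟩ : WeierstrassCurve ℚ) := by
  ext <;> simp [WeierstrassCurve.baseChange, WeierstrassCurve.map]

/-- The integer model of `T′`. [cite: SilvermanAEC2009, VIII.8] -/
theorem intModel_T37A1 :
    haveI := isElliptic_T37A1; haveI := isGloballyMinimal_T37A1
    integralModelInt (⟨0, 0, 1, -49, -86⟩ : WeierstrassCurve ℚ) = (⟨0, 0, 1, -49, -86⟩ : WeierstrassCurve ℤ) :=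
  haveI := isElliptic_T37A1; haveI := isGloballyMinimal_T37A1
  integralModelInt_eq_of_map_eq _ (by ext <;> simp [WeierstrassCurve.map])

/-- **`N(T′) ∣ |Δ_min| = 4353013`.** [cite: SilvermanAEC2009, VIII.11 and C.16] -/
theorem conductorNorm_dvd_T37A1 :
    haveI := isElliptic_T37A1
    (⟨0, 0, 1, -49, -86⟩ : WeierstrassCurve ℚ).conductorNorm ℤ ∣ 4353013 := by
  haveI := isElliptic_T37A1; haveI := isGloballyMinimal_T37A1
  have hdvd := WeierstrassCurve.conductorNorm_dvd_minimalDiscriminantNorm (⟨0, 0, 1, -49, -86⟩ : WeierstrassCurve ℚ)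
    (WeierstrassCurve.finite_setOf_ordMinimalDiscriminant_ne_zero_holds _)
  rw [WeierstrassCurve.minimalDiscriminantNorm_int_eq_natAbs_minimalDiscriminantInt_holds,
    minimalDiscriminantInt_eq intModel_T37A1, MT37A1_Δ] at hdvd
  exact hdvd

/-- **Tate certificate for `T′` at `7`, kernel check** (Steps 1–6): translate by `(r,s,t) = (0,0,24)` to `[0,0,49,−49,−686]` (`7 ∣ a₂`, `7² ∣ a₃, a₄`,
`7³ ∣ a₆`); Step 6 exit: the cubic `T³ − T − 2` has distinct roots mod `7` (discriminant `−104 ≢ 0`) — type `I₀*`, `v₇(Δ) = 6`.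
[cite: Silverman1994, IV.9.4 Steps 1–6] -/
theorem tateDeepCheck_seven_T37A1 : DeepCert.check ⟨7, 0, 0, 24, 6, 6, 0⟩ ⟨0, 0, 1, -49, -86⟩ = true := by
  decide +kernel

/-- **`f₇(T′) = 2`** (Ogg: `6 + 1 − 5` components of `I₀*`). [cite: Silverman1994, IV.11.1] -/
theorem conductorExponent_seven_T37A1 (v : HeightOneSpectrum ℤ) (hv : natGenerator v = 7) :
    (⟨0, 0, 1, -49, -86⟩ : WeierstrassCurve ℚ).conductorExponent v = 2 := by
  have h := DeepCert.conductorExponent_int_eq (W₀ := ⟨0, 0, 1, -49, -86⟩) (c := ⟨7, 0, 0, 24, 6, 6, 0⟩) v hv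
    (by rw [baseChange_int_T37A1]; exact isGloballyMinimal_T37A1) tateDeepCheck_seven_T37A1
  rw [baseChange_int_T37A1] at h
  exact h

/-- **`ord₇ N(T′) = 2`, `ord₃₇ N(T′) = 1`** (the latter: multiplicative at `37`, `37 ∣ Δ`, `37 ∤ c₄`). [cite: Silverman1994, IV.11.1] -/
theorem factorization_conductorNorm_T37A1 :
    haveI := isElliptic_T37A1
    (((⟨0, 0, 1, -49, -86⟩ : WeierstrassCurve ℚ).conductorNorm ℤ).factorization 7 = 2) ∧
      (((⟨0, 0, 1, -49, -86⟩ : WeierstrassCurve ℚ).conductorNorm ℤ).factorization 37 = 1) := by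
  haveI := isElliptic_T37A1; haveI := isGloballyMinimal_T37A1
  haveI hE : ((⟨0, 0, 1, -49, -86⟩ : WeierstrassCurve ℤ).baseChange ℚ).IsElliptic := by rw [baseChange_int_T37A1]; infer_instance
  have h7 : Nat.Prime 7 := by norm_num
  have h37 : Nat.Prime 37 := by norm_num
  refine ⟨?_, ?_⟩
  · rw [show (7 : ℕ) = ((⟨7, h7⟩ : Nat.Primes) : ℕ) from rfl, factorization_conductorNorm_primesEquiv_symm]
    exact conductorExponent_seven_T37A1 _ (congrArg Subtype.val ((primesEquiv (R := ℤ)).apply_symm_apply ⟨7, h7⟩))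
  · set v : HeightOneSpectrum ℤ := (primesEquiv (R := ℤ)).symm ⟨37, h37⟩ with hv
    have hgen : natGenerator v = 37 := congrArg Subtype.val ((primesEquiv (R := ℤ)).apply_symm_apply ⟨37, h37⟩)
    have hmin : ((⟨0, 0, 1, -49, -86⟩ : WeierstrassCurve ℤ).baseChange ℚ).IsMinimalAt v := by
      rw [baseChange_int_T37A1]; exact IsGloballyMinimal.isMinimalAt_int _ v
    have h1 : ((⟨0, 0, 1, -49, -86⟩ : WeierstrassCurve ℤ).baseChange ℚ).conductorExponent v = 1 :=
      conductorExponent_eq_one_of_dvd_Δ_of_not_dvd_c₄ hmin (by rw [hgen, MT37A1_Δ]; decide) (by rw [hgen, MT37A1_c₄]; decide)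
    rw [baseChange_int_T37A1] at h1
    rw [show (37 : ℕ) = ((⟨37, h37⟩ : Nat.Primes) : ℕ) from rfl, factorization_conductorNorm_primesEquiv_symm]
    exact h1

/-- The prime factorisation of `7ᵃ·37ᵇ`, read coefficientwise. [folklore] -/
theorem factorization_seven_pow_mul_thirtyseven_pow (a b q : ℕ) :
    (7 ^ a * 37 ^ b).factorization q = if q = 7 then a else if q = 37 then b else 0 := by
  have h7 : Nat.Prime 7 := by norm_num
  have h37 : Nat.Prime 37 := by norm_num
  rw [Nat.factorization_mul (pow_ne_zero _ h7.ne_zero) (pow_ne_zero _ h37.ne_zero), Finsupp.add_apply,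
    Nat.factorization_pow, Nat.factorization_pow, Finsupp.smul_apply, Finsupp.smul_apply, h7.factorization, h37.factorization,
    Finsupp.single_apply, Finsupp.single_apply]
  by_cases hq7 : q = 7
  · subst hq7; simp
  by_cases hq37 : q = 37
  · subst hq37; simp
  · simp [Ne.symm hq7, Ne.symm hq37, hq7, hq37]

/-- **`N(T′) = 1813 = 7²·37` IN THE KERNEL** (`N ∣ 7⁶·37`, `ord₇ N = 2`, `ord₃₇ N = 1`). [cite: CremonaAlgorithms1997, Table 1 (conductor 1813)] -/
theorem conductorNorm_T37A1 :
    haveI := isElliptic_T37A1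
    (⟨0, 0, 1, -49, -86⟩ : WeierstrassCurve ℚ).conductorNorm ℤ = 1813 := by
  haveI := isElliptic_T37A1
  set N := (⟨0, 0, 1, -49, -86⟩ : WeierstrassCurve ℚ).conductorNorm ℤ with hN
  have hN0 : N ≠ 0 := (conductorNorm_pos_holds _).ne'
  obtain ⟨h7, h37⟩ := factorization_conductorNorm_T37A1
  have hle := (Nat.factorization_le_iff_dvd hN0 (by norm_num : (4353013 : ℕ) ≠ 0)).mpr conductorNorm_dvd_T37A1
  have e1813 : (1813 : ℕ) = 7 ^ 2 * 37 ^ 1 := by norm_num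
  have eΔ : (4353013 : ℕ) = 7 ^ 6 * 37 ^ 1 := by norm_num
  refine Nat.eq_of_factorization_eq hN0 (by norm_num) fun q => ?_
  rw [e1813, factorization_seven_pow_mul_thirtyseven_pow]
  by_cases hq7 : q = 7
  · subst hq7; rw [h7]; simp
  by_cases hq37 : q = 37
  · subst hq37; rw [h37]; simp
  have hq' := hle q
  rw [eΔ, factorization_seven_pow_mul_thirtyseven_pow, if_neg hq7, if_neg hq37] at hq'
  rw [if_neg hq7, if_neg hq37]
  exact Nat.le_zero.mp hq'

/-- **`N(T′) < 5000`** (Creutz–Miller's range). [cite: CreutzMiller2012, Thm. 1.1] -/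
theorem conductorNorm_lt_5000_T37A1 :
    haveI := isElliptic_T37A1
    (⟨0, 0, 1, -49, -86⟩ : WeierstrassCurve ℚ).conductorNorm ℤ < 5000 := by
  rw [conductorNorm_T37A1]; norm_num

end Partner37A1

/-! ## §3 The packet witness `ℓ = 53`: `#Ẽ(𝔽₅₃) = 53` (`a₅₃ = 1` odd), so `53 ∈ 𝒮(37a1, ℚ(√−7))` once `(−7/53) = 1` is read (road file) -/
section Witness37A1

/-- **`#Ẽ(𝔽₅₃) = 53` for `37a1`** (certified count; `53 ∤ Δ = 37`), so `a₅₃ = 54 − 53 = 1`. [cite: SilvermanAEC2009, V.2] -/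
theorem reductionPointCount_53_37A1 :
    haveI := isGloballyMinimal_37A1
    E.reductionPointCount 53 = 53 := by
  haveI : Fact (Nat.Prime 53) := ⟨by norm_num⟩
  haveI := isGloballyMinimal_37A1
  exact Supersingular.reductionPointCount_eq_of_intModel_countPoints intModel_37A1 53 (by norm_num) (by decide +kernel)
    (by decide +kernel)

/-- **`a₅₃(37a1)` is odd** (`= 1`: `Frob₅₃` has order `3` on `E[2]`). [cite: KrizLi2019, Def. 4.1 ("Frob_ℓ of order 3")] -/
theorem odd_frobeniusTrace_53_37A1 :
    haveI := isGloballyMinimal_37A1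
    Odd (E.frobeniusTrace 53) := by
  haveI := isGloballyMinimal_37A1
  rw [Uniform.U2.odd_frobeniusTrace_iff_odd_reductionPointCount _ (by norm_num : Nat.Prime 53) (by norm_num),
    reductionPointCount_53_37A1]
  decide

end Witness37A1

end Summit.BirchSwinnertonDyer.BirchSwinnertonDyer.Theorems.GenusExact.TwinSwap.KrizLiAnchor37a1

end
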